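import Summits.SmoothPoincare4.SmoothPoincare4.Theses.WeakReductionDescent
import Summits.SmoothPoincare4.SmoothPoincare4.Theorems.WeakReductionDescentWeakReductionReducesStubLoopDichotomyFromFiveCoreAux1
import Literature.Barriers.SmoothPoincare4.WeaklyReducibleGenusThreeStandard
import HarnessLib

/-!
# Crux `WeakReductionReduces` (stmt-SmoothPoincare4-17908), line `loop_dichotomy` — toolkit for the
# cores CORE₄ⁿ / CORE₅ⁿ: the NORMAL FORM of a fixed-label weak reduction of a homotopy 4-sphere

Lead seat c2 (2026-08-17).  **Everything here is proved; no definition and no named fact is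
introduced.**  Registered helper: `helper_weakReduction_normalForm` (stub-add on the crux; lands
`--supports stmt-SmoothPoincare4-17908`).

Let `T` be a Gay–Kirby `(g; k)`-trisection of a smooth `4`-manifold `M` and `(c; c′)` a weak
reduction WITH FIXED LABELS: `c`, `c′` disjoint non-separating curves of the central surface `F`,
`c` bounding a compressing disc in `H₀ = T 1 ∩ T 2`, `c′` in `H₁ = T 0 ∩ T 2` and in
`H₂ = T 0 ∩ T 1` (the hypothesis shape of the registered cores `stub_loopDichotomyFourCoreNorm`,
`stub_loopDichotomyFromFiveCorePos`).  Two PROVED tree theorems extract, for free, the first lines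
of any proof of the cores:

* the structural lemma `one_le_kZero_of_doublyCompressing_nonseparating` (wave 2 of this line,
  `…StubLoopDichotomyFromFiveCoreAux1`): a non-separating curve compressing in `H₁` and `H₂` forces
  `1 ≤ k 0` — here transported along an arbitrary relabelling `σ` of the sectors
  (`one_le_k_perm_of_doublyCompressing`), whence: `c` compressing also in `H₁` forces `1 ≤ k 2`,
  `c` compressing also in `H₂` forces `1 ≤ k 1`;
* `Trisection.not_simplyConnectedSpace_of_reducing_nonseparating`
  (`ReducibleTrisectionNotSimplyConnected.lean`): a non-separating curve compressing in all three
  handlebodies makes `π₁(M) ≠ 1` — so for a homotopy sphere (`M ≃ₕ S⁴`, simply connected by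
  `simplyConnectedSpace_sphere_four_holds`) NEITHER curve of a weak reduction is a reducing curve:
  `c′` does not compress in `H₀`, and `c` does not compress in both `H₁` and `H₂`.

`helper_weakReduction_normalForm` packages the five consequences for a homotopy sphere:
`1 ≤ k 0`, `¬ BoundsDisc H₀ c′`, `¬ (BoundsDisc H₁ c ∧ BoundsDisc H₂ c)`,
`BoundsDisc H₁ c → 1 ≤ k 2`, `BoundsDisc H₂ c → 1 ≤ k 1`.  At genus `4`, type `(2; 2, 0)`
(`k 2 = 0`), the fourth says that `c` compresses in `H₀` ONLY or in `H₀` and `H₂`.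

## References

* R. Aranda, A. Zupan, *Manifolds with weakly reducible genus-three trisections are standard*,
  arXiv:2503.04607 (2025), §2 (p. 6: reducing vs. weakly reducing curves; the labels), p. 21.
  [ArandaZupan2025]
* A. Hatcher, *Algebraic Topology*, CUP (2002), Prop. 1.14, Prop. 1.26. [HatcherAT2002]
-/

-- the registered namespace `Summit.SmoothPoincare4.SmoothPoincare4.Theorems…` repeats a component
set_option linter.dupNamespace false

noncomputable section

open Set Function
open scoped Manifold ContDiff Topology ContinuousMap
open Literature.Topology.FourManifolds Literature.Topology.FourManifolds.Trisection

namespace Summit.SmoothPoincare4.SmoothPoincare4.Theorems.WeakReductionReduces.LoopDichotomy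

universe u

variable {X : Type u} [TopologicalSpace X] [T2Space X] [SecondCountableTopology X]
  [ChartedSpace (EuclideanSpace ℝ (Fin 4)) X] [IsManifold (𝓡 4) ∞ X]
  {g : ℕ} {k : Fin 3 → ℕ} {S : Fin 3 → Set X}

/-! ### The structural lemma along a relabelling of the sectors -/

/-- **Structural lemma, relabelled.**  For a Gay–Kirby trisection `S` and a permutation `σ` of the
labels: a non-separating curve of the central surface compressing in `H_{σ 1}` and in `H_{σ 2}`
forces `1 ≤ k (σ 0)` (apply `one_le_kZero_of_doublyCompressing_nonseparating` to the relabelled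
trisection `S ∘ σ`, whose handlebody opposite `p` is `H_{σ p}`). [cite: ArandaZupan2025, §2 (p. 6)] -/
theorem one_le_k_perm_of_doublyCompressing (h : IsGKTrisection X g k S) (σ : Equiv.Perm (Fin 3))
    {δ : Set X} (hc : IsCurve S δ) (hns : IsNonSeparating S δ)
    (h1 : BoundsDisc S (spineHandlebody S (σ 1)) δ) (h2 : BoundsDisc S (spineHandlebody S (σ 2)) δ) :
    1 ≤ k (σ 0) := by
  have h' : IsGKTrisection X g (k ∘ σ) (S ∘ σ) := h.comp_perm σ
  have hc' : IsCurve (S ∘ σ) δ :=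
    (Literature.Barriers.SmoothPoincare4.Trisection.isCurve_comp_perm S σ δ).2 hc
  have hns' : IsNonSeparating (S ∘ σ) δ :=
    (Literature.Barriers.SmoothPoincare4.Trisection.isNonSeparating_comp_perm S σ δ).2 hns
  have hdisc : ∀ q : Fin 2, BoundsDisc (S ∘ σ) (spineHandlebody (S ∘ σ) q.succ) δ := by
    intro q
    rw [Literature.Barriers.SmoothPoincare4.Trisection.spineHandlebody_comp_perm,
      Literature.Barriers.SmoothPoincare4.Trisection.boundsDisc_comp_perm]
    fin_cases q
    · exact h1
    · exact h2
  exact one_le_kZero_of_doublyCompressing_nonseparating h' hc' hdisc hns'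

/-- A non-separating curve compressing in `H₀` and in `H₁` forces `1 ≤ k 2` (`H₀ ∪_F H₁ = ∂(S 2)`
is `#^{k 2}(S¹ × S²)` and carries a non-separating reducing sphere). [cite: ArandaZupan2025, §2 (p. 6)] -/
theorem one_le_kTwo_of_compressing_zero_one (h : IsGKTrisection X g k S) {δ : Set X}
    (hc : IsCurve S δ) (hns : IsNonSeparating S δ)
    (h0 : BoundsDisc S (spineHandlebody S 0) δ) (h1 : BoundsDisc S (spineHandlebody S 1) δ) :
    1 ≤ k 2 := by
  have hσ0 : (finRotate 3).symm 0 = (2 : Fin 3) := by decide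
  have hσ1 : (finRotate 3).symm 1 = (0 : Fin 3) := by decide
  have hσ2 : (finRotate 3).symm 2 = (1 : Fin 3) := by decide
  have := one_le_k_perm_of_doublyCompressing h (finRotate 3).symm hc hns (by rw [hσ1]; exact h0)
    (by rw [hσ2]; exact h1)
  rwa [hσ0] at this

/-- A non-separating curve compressing in `H₂` and in `H₀` forces `1 ≤ k 1` (`H₂ ∪_F H₀ = ∂(S 1)`).
[cite: ArandaZupan2025, §2 (p. 6)] -/
theorem one_le_kOne_of_compressing_two_zero (h : IsGKTrisection X g k S) {δ : Set X}
    (hc : IsCurve S δ) (hns : IsNonSeparating S δ)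
    (h2 : BoundsDisc S (spineHandlebody S 2) δ) (h0 : BoundsDisc S (spineHandlebody S 0) δ) :
    1 ≤ k 1 := by
  have hσ0 : (finRotate 3) 0 = (1 : Fin 3) := by decide
  have hσ1 : (finRotate 3) 1 = (2 : Fin 3) := by decide
  have hσ2 : (finRotate 3) 2 = (0 : Fin 3) := by decide
  have := one_le_k_perm_of_doublyCompressing h (finRotate 3) hc hns (by rw [hσ1]; exact h2)
    (by rw [hσ2]; exact h0)
  rwa [hσ0] at this

/-! ### In a simply connected `4`-manifold no weak-reduction curve is a reducing curve -/

/-- In a simply connected trisected `4`-manifold, a non-separating curve compressing in `H₁` and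
`H₂` does not compress in `H₀` (it would be a non-separating reducing curve, and then
`π₁ ≠ 1` by `Trisection.not_simplyConnectedSpace_of_reducing_nonseparating`). [cite: HatcherAT2002, Prop. 1.26] -/
theorem not_boundsDisc_zero_of_one_two [SimplyConnectedSpace X] (h : IsGKTrisection X g k S)
    {δ : Set X} (hc : IsCurve S δ) (hns : IsNonSeparating S δ)
    (h1 : BoundsDisc S (spineHandlebody S 1) δ) (h2 : BoundsDisc S (spineHandlebody S 2) δ) :
    ¬ BoundsDisc S (spineHandlebody S 0) δ := by
  intro h0
  refine Trisection.not_simplyConnectedSpace_of_reducing_nonseparating h hc (fun q => ?_) hns ‹_›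
  fin_cases q
  · exact h0
  · exact h1
  · exact h2

/-- In a simply connected trisected `4`-manifold, a non-separating curve compressing in `H₀` does
not compress in both `H₁` and `H₂`. [cite: HatcherAT2002, Prop. 1.26] -/
theorem not_boundsDisc_one_and_two_of_zero [SimplyConnectedSpace X] (h : IsGKTrisection X g k S)
    {δ : Set X} (hc : IsCurve S δ) (hns : IsNonSeparating S δ)
    (h0 : BoundsDisc S (spineHandlebody S 0) δ) :
    ¬ (BoundsDisc S (spineHandlebody S 1) δ ∧ BoundsDisc S (spineHandlebody S 2) δ) := by
  rintro ⟨h1, h2⟩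
  exact not_boundsDisc_zero_of_one_two h hc hns h1 h2 h0

/-- A space homotopy equivalent to the round `4`-sphere is simply connected (proved tree input
`simplyConnectedSpace_sphere_four_holds` + Mathlib transport). [cite: HatcherAT2002, Prop. 1.14] -/
theorem simplyConnectedSpace_of_homotopyEquiv_sphereFour {M : Type u} [TopologicalSpace M]
    (e : M ≃ₕ (Metric.sphere (0 : EuclideanSpace ℝ (Fin 5)) 1)) : SimplyConnectedSpace M :=
  haveI : SimplyConnectedSpace (Metric.sphere (0 : EuclideanSpace ℝ (Fin 5)) 1) :=
    simplyConnectedSpace_sphere_four_holds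
  e.simplyConnectedSpace

/-! ### The registered helper: normal form of a fixed-label weak reduction of a homotopy sphere -/

/-- **`helper_weakReduction_normalForm`** (registered helper of crux stmt-SmoothPoincare4-17908,
line `loop_dichotomy`; serves the cores `stub_loopDichotomyFourCoreNorm` /
`stub_loopDichotomyFromFiveCorePos`).  For a smooth homotopy `4`-sphere `M` with a Gay–Kirby
`(g; k)`-trisection `T` and a fixed-label weak reduction (`c` compressing in `H₀`, `c′` in `H₁` and
`H₂`, both non-separating curves of the central surface): `1 ≤ k 0`; `c′` does NOT compress in
`H₀`; `c` does NOT compress in both `H₁` and `H₂`; if `c` compresses in `H₁` then `1 ≤ k 2`; if `c`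
compresses in `H₂` then `1 ≤ k 1`.  (Neither curve of a weak reduction of a homotopy sphere is a
reducing curve; every doubly compressing non-separating curve sees a `S¹ × S²` summand of the
corresponding sector boundary.) [cite: ArandaZupan2025, §2 (p. 6), p. 21] [cite: HatcherAT2002, Prop. 1.26] -/
theorem helper_weakReduction_normalForm :
    ∀ (M : Type) [TopologicalSpace M] [T2Space M] [SecondCountableTopology M] [ChartedSpace (EuclideanSpace ℝ (Fin 4)) M] [IsManifold (𝓡 4) ((⊤ : ℕ∞) : WithTop ℕ∞) M], (M ≃ₕ (Metric.sphere (0 : EuclideanSpace ℝ (Fin 5)) 1)) → ∀ (g : ℕ) (k : Fin 3 → ℕ) (T : Fin 3 → Set M), Literature.Topology.FourManifolds.IsGKTrisection M g k T → ∀ (c c' : Set M), Literature.Topology.FourManifolds.Trisection.IsCurve T c → Literature.Topology.FourManifolds.Trisection.IsCurve T c' → Literature.Topology.FourManifolds.Trisection.IsNonSeparating T c → Literature.Topology.FourManifolds.Trisection.IsNonSeparating T c' → Literature.Topology.FourManifolds.Trisection.BoundsDisc T (Literature.Topology.FourManifolds.Trisection.spineHandlebody T 0) c → Literature.Topology.FourManifolds.Trisection.BoundsDisc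 T (Literature.Topology.FourManifolds.Trisection.spineHandlebody T 1) c' → Literature.Topology.FourManifolds.Trisection.BoundsDisc T (Literature.Topology.FourManifolds.Trisection.spineHandlebody T 2) c' → (1 ≤ k 0 ∧ ¬ Literature.Topology.FourManifolds.Trisection.BoundsDisc T (Literature.Topology.FourManifolds.Trisection.spineHandlebody T 0) c' ∧ ¬ (Literature.Topology.FourManifolds.Trisection.BoundsDisc T (Literature.Topology.FourManifolds.Trisection.spineHandlebody T 1) c ∧ Literature.Topology.FourManifolds.Trisection.BoundsDisc T (Literature.Topology.FourManifolds.Trisection.spineHandlebody T 2) c) ∧ (Literature.Topology.FourManifolds.Trisection.BoundsDisc T (Literature.Topology.FourManifolds.Trisection.spineHandlebody T 1) c → 1 ≤ k 2) ∧ (Literature.Topology.FourManifolds.Trisection.BoundsDisc T (Literature.Topology.FourManifolds.Trisection.spineHandlebody T 2) c → 1 ≤ k 1)) := by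
  intro M _ _ _ _ _ e g k T hT c c' hc hc' hn hn' hb0 hb1 hb2
  haveI : SimplyConnectedSpace M := simplyConnectedSpace_of_homotopyEquiv_sphereFour e
  exact ⟨one_le_kZero_of_doublyCompressing_nonseparating hT hc' (fun q => by
      fin_cases q
      · exact hb1
      · exact hb2) hn',
    not_boundsDisc_zero_of_one_two hT hc' hn' hb1 hb2,
    not_boundsDisc_one_and_two_of_zero hT hc hn hb0,
    fun h1 => one_le_kTwo_of_compressing_zero_one hT hc hn hb0 h1,
    fun h2 => one_le_kOne_of_compressing_two_zero hT hc hn h2 hb0⟩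

end Summit.SmoothPoincare4.SmoothPoincare4.Theorems.WeakReductionReduces.LoopDichotomy

end
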